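import Mathlib
import Summits.Ventures.PercRepro.TriangleCapSevenTen

/-!
# PercRepro — THE CELL COUNT, PACKAGED (p3, gen 32; part 23)

Every cell theorem of TriangleCapSevenTen … TriangleCapRowPlusSix repeats the same sixty lines: at a vertex `v` the
split of `2 Σ d²` (TriangleCapDiagonal), the counts at `v`, the matching pairs `T = 2M ≤ d(v)` with `T² ≤ 2Y + 2T`,
`|R| = 2(m − d)`, the dominating identification `T = |R|`, the defect sum seen from a vertex of maximum off-degree
`δ` and the split sum over the matching pairs.  **`cell_count`** packages them as one existential statement about
the numbers `T, M, |R|, Y, m′, δ`, so that a cell closes by choosing `v` of maximum degree, obtaining the numbers, and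
running the case analysis on `d(v)` — the shape the generator mining/p3/g32/gen_cells.py writes.  Axioms: standard.
-/

namespace PercRepro

namespace TriangleCap

namespace C047

open Finset

variable {V : Type*} [Fintype V] [DecidableEq V]

/-- **The cell count at a vertex `v`, packaged.**  With `T` the ordered matching pairs inside `N(v)` (`T = 2M`), `Rc = |R|`
the ordered pairs off `v`, `Y` their defect sum, `Ec = m′` the edges off `v` and `δ` the maximum off-degree:
`T ≤ d`, `T² ≤ 2Y + 2T`, `2m = 2d + |R|`, `m′ = m − d`, `T = |R|` when `v` dominates, `d + 1 ≤ k`, `δ ≤ max degree`,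
the defect sum seen from the vertex of maximum off-degree, the split sum, and the combined count
`2(2·cherries + 2m) + |R|·d + Y ≤ 2d² + 2d + 2|R| + 2T + |R|·m + |R|`. -/
theorem cell_count (D : SimpleGraph V) [DecidableRel D.Adj] (hK : K4mFree D) (v : V)
    (hmax : ∀ w, deg D w ≤ deg D v) :
    ∃ T M Rc Y Ec δ : ℕ,
      T = 2 * M ∧ T ≤ deg D v ∧ T * T ≤ 2 * Y + 2 * T ∧
      2 * D.edgeFinset.card = deg D v + (deg D v + Rc) ∧ Ec = D.edgeFinset.card - deg D v ∧
      (deg D v + 1 = Fintype.card V → T = Rc) ∧ deg D v + 1 ≤ Fintype.card V ∧ δ ≤ deg D v ∧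
      (Rc - 2 * δ) * (δ - 2) + (Ec - δ) * (2 * δ - 4) ≤ Y ∧
      T * (Ec + deg D v - Fintype.card V) + (Rc - T) * (Ec + 1 - 2 * δ) ≤ Y ∧
      2 * (2 * cherries D + 2 * D.edgeFinset.card) + Rc * deg D v + Y ≤
        2 * (deg D v * deg D v) + 2 * deg D v + 2 * Rc + 2 * T + Rc * D.edgeFinset.card + Rc := by
  have hS := sum_adjPairsAll_deg_add D
  have hsplit1 := sum_filter_add_sum_filter_not (adjPairsAll D) (fun p => p.1 = v)
    (fun p => deg D p.1 + deg D p.2)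
  have hsplit2 := sum_filter_add_sum_filter_not ((adjPairsAll D).filter (fun p => ¬ p.1 = v))
    (fun p => p.2 = v) (fun p => deg D p.1 + deg D p.2)
  rw [filter_not_fst_filter_snd, filter_not_fst_filter_not_snd] at hsplit2
  have hfst := sum_filter_fst_deg_add D v
  have hsnd := sum_filter_snd_deg_add D v
  have hA := sum_deg_neighbors_eq D v
  have hE := two_mul_card_E_le D v
  have hT := card_T_le_deg D hK v
  have hTT := card_T_mul_card_T_le D hK v
  have hTM := card_T_eq_two_mul D v
  have hRc := two_mul_card_edges_eq D v
  have hR1 := sum_R_add_sum_avoid_le D v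
  have hc := two_mul_cherries_add D
  rw [sum_deg_eq] at hc
  have hdk : deg D v + 1 ≤ Fintype.card V := by
    have hsub : univ.filter (fun w => D.Adj v w) ⊆ univ.erase v := by
      intro w hw
      rw [mem_filter] at hw
      rw [mem_erase]
      exact ⟨(D.ne_of_adj hw.2).symm, mem_univ _⟩
    have h1 : deg D v ≤ (univ.erase v).card := card_le_card hsub
    rw [card_erase_of_mem (mem_univ v), card_univ] at h1
    have h2 : 1 ≤ Fintype.card V := Fintype.card_pos_iff.mpr ⟨v⟩
    omega
  have hmain : 2 * (∑ x, deg D x * deg D x) + (offPairs D v).card * deg D v +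
      ∑ p ∈ offPairs D v, (avoid D v p).card ≤
      2 * (deg D v * deg D v) + 2 * deg D v +
        4 * ((offPairs D v).filter (fun p => D.Adj v p.1)).card +
        (offPairs D v).card * D.edgeFinset.card + (offPairs D v).card := by
    linarith [hS, hsplit1, hsplit2, hfst, hsnd, hA, hR1]
  have hdom : deg D v + 1 = Fintype.card V →
      ((offPairs D v).filter (fun p => D.Adj v p.1 ∧ D.Adj v p.2)).card = (offPairs D v).card :=
    fun h => congrArg card (filter_T_eq_offPairs_of_deg_add_one_eq_card D h)
  have hEc := card_offEdges D v
  obtain ⟨c, -, hcmax⟩ := exists_max_image univ (outDeg D v) ⟨v, mem_univ v⟩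
  have hcmax' : ∀ w, outDeg D v w ≤ outDeg D v c := fun w => hcmax w (mem_univ w)
  have hδd : outDeg D v c ≤ deg D v := (outDeg_le_deg D v c).trans (hmax c)
  have hδ1 := sum_avoid_ge_of_outDeg D v c
  have hL := sum_avoid_ge_of_T_of_outDeg_le D hK v (outDeg D v c) hcmax'
  refine ⟨((offPairs D v).filter (fun p => D.Adj v p.1 ∧ D.Adj v p.2)).card,
    (((offPairs D v).filter (fun p => D.Adj v p.1 ∧ D.Adj v p.2)).image (fun q => s(q.1, q.2))).card,
    (offPairs D v).card, ∑ p ∈ offPairs D v, (avoid D v p).card, (offEdges D v).card, outDeg D v c,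
    hTM, hT, hTT, hRc, hEc, hdom, hdk, hδd, hδ1, hL, ?_⟩
  rw [hc]
  linarith [hmain, hE]

omit [DecidableEq V] in
/-- A vertex of maximum degree exists, and it has degree `≥ 5` if some vertex does. -/
theorem exists_max_deg (D : SimpleGraph V) [DecidableRel D.Adj] {u : V} (hu : 5 ≤ deg D u) :
    ∃ v, (∀ w, deg D w ≤ deg D v) ∧ 5 ≤ deg D v := by
  obtain ⟨v, -, hmax⟩ := exists_max_image univ (deg D) ⟨u, mem_univ u⟩
  exact ⟨v, fun w => hmax w (mem_univ w), (hmax u (mem_univ u)).trans' hu⟩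

omit [DecidableEq V] in
/-- The degree cap: if every degree is `≤ 4` then `cherries ≤ 3m`. -/
theorem cherries_le_three_mul_of_deg_le_four (D : SimpleGraph V) [DecidableRel D.Adj]
    (hdeg : ∀ v, deg D v ≤ 4) : cherries D ≤ 3 * D.edgeFinset.card := by
  have h2 : 2 * cherries D ≤ (4 - 1) * ∑ v, deg D v := by
    unfold cherries
    rw [mul_sum, mul_sum]
    exact sum_le_sum (fun v _ => two_mul_choose_two_le_pred_mul _ _ (hdeg v))
  rw [sum_deg_eq] at h2
  omega

end C047

end TriangleCap

end PercRepro
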